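import Literature.Geometry.Symplectic.PlusOneSpherePair
import Literature.Geometry.Symplectic.SymplecticOrientation
import Literature.Geometry.Symplectic.ThomGysinComplementSurfaceFour
import Literature.AlgebraicTopology.SingularHomology.SmoothEmbeddingComplement
import Literature.Topology.FourManifolds.SecondHomologyOfFirstHomologyZero
import HarnessLib

/-!
# Homological reading of the hypotheses of `mcduff_plusOneSphere_pairDiffeomorph`:
# `H₁(N; ℤ) = 0`, `H₂(N; ℤ) ≅ ℤ` and `[S]·[S] = ±1`

Sibling proof file of `PlusOneSpherePair.lean` (named fact
`Literature.Geometry.Symplectic.mcduff_plusOneSphere_pairDiffeomorph`; McDuff 1990, Thm. 1.4 with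
Cor. 1.5 (i); Wendl 2018, Thm. 6.9 (2)). The fact replaces the printed hypotheses
"`[S]·[S] = 1` and `N` minimal" by the homological ones `rank H₂(N; ℤ) = 1`, `H₁(N ∖ b(S); ℤ) = 0`,
and its module docstring derives the former from the latter in four steps:

1. `H₁(N ∖ S) = 0 ⇒ H₁(N) = 0` (the pair `(N, N ∖ S)` has no homology below the codimension `2`);
2. `H₂(N; ℤ)` is then torsion-free (universal coefficients and Poincaré duality for the
   symplectically oriented `N`), hence `H₂(N; ℤ) = ℤh` by the rank hypothesis;
3. `x ↦ x·[S]` maps `H₂(N)` onto `ℤ` (Thom isomorphism `H₂(N, N ∖ S) ≅ ℤ` and the exact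
   sequence), so `[S] = ±h` and `[S]·[S] = h·h = ±1` (unimodularity);
4. `h·h = +1` because `[s]² > 0` in the symplectic orientation; and no class has square `−1`.

This file PROVES steps 1–3 for the data of the fact (everything but the symplectic sign of step 4),
from the bricks landed for it in the tree and the tree's PROVED Thom–Gysin sequence of the
complement of a surface (`thomGysin_complement_surface_four_holds`, Bredon 1993 VI.11):

* `PlusOneSpherePair.subsingleton_H1` — **step 1**: under (a subset of) the hypotheses of the fact,
  `H₁(N; ℤ) = 0` (`subsingleton_singularHomology_one_of_isSmoothEmbedding_two_four`,
  `AlgebraicTopology/SingularHomology/SmoothEmbeddingComplement.lean`: smooth embeddings are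
  locally flat, and the tree's engine for complements of locally flat closed subsets,
  Kosinski 1993 X.1 Prop. (1.1));
* `PlusOneSpherePair.nonempty_H2_equiv_int`, `free_H2` — **step 2**: `H₂(N; ℤ) ≃ₗ[ℤ] ℤ`, in
  particular free (`nonempty_singularHomology_two_equiv_int_of_finrank_eq_one`,
  `Topology/FourManifolds/SecondHomologyOfFirstHomologyZero.lean`: Kirby 1989 Ch. II §1 under
  `H₁ = 0`, Poincaré duality being the tree's theorem `poincare_duality`), the `ℤ`-orientation of
  `N` being the SYMPLECTIC one, `symplecticOrientation s` (`SymplecticOrientation.lean`,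
  McDuff–Salamon 2017 Cor. 2.1.4: `s ∧ s ≠ 0`).

* `PlusOneSpherePair.cupPairing_flip_surjective`, `selfIntersection_eq_one_or_eq_neg_one`,
  `cupPairing_self_eq_sq_mul_selfIntersection` — **step 3**, for ANY `ℤ`-orientations `μ` of `N`
  and `μS` of `S` and the Poincaré dual `σ` of `b_*[S]` (`σ ⌢ [N] = b_*[S]`; it exists and is
  unique, `existsUnique_poincareDual`): since `H₁(N ∖ S) = 0` kills the connecting map `δ` of the
  Thom–Gysin sequence, `a ↦ ⟨a ∪ σ, [N]⟩ = a·[S]` maps `H²(N; ℤ)` ONTO `ℤ`; as `H²(N; ℤ) ≅ ℤ`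
  (steps 1–2 and Poincaré duality), `σ` is a generator up to sign and **`[S]·[S] = ⟨σ ∪ σ, [N]⟩ = ±1`**,
  every class `c` having `c·c = k² · [S]·[S]` — so `[S]·[S] = +1` is equivalent to "no class of
  square `−1`" (`forall_cupPairing_self_ne_neg_one_iff`), the homological form of minimality.

Only smoothness and non-degeneracy of `s` (for the symplectic orientation; steps 1–3 are stated for
an arbitrary orientation `μ`), the smooth embedding `b` of the compact connected `S`, and the two
homological hypotheses are used (closedness of `s`, `S ≅ S²` and the symplectic property of `b(S)`
enter only the sign, step 4: `[s]² > 0` in the symplectic orientation, i.e. `b⁺ ≥ 1`, which is NOT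
here). Everything is proved; no definitions, no named facts.

## References

* D. McDuff, *The structure of rational and ruled symplectic 4-manifolds*, J. Amer. Math. Soc. 3
  (1990) 679–712, Thm. 1.4, Cor. 1.5 (i) [McDuff1990].
* R. C. Kirby, *The Topology of 4-Manifolds*, LNM 1374 (1989), Ch. II §1 [Kirby1989].
* A. Kosinski, *Differential Manifolds* (1993), X.1 Prop. (1.1) [Kosinski1993].
* G. Bredon, *Topology and Geometry* (1993), VI.9.4, VI.11 (the steps not formalized here)
  [Bredon1993].
-/

noncomputable section

open scoped Manifold ContDiff Topology
open Set Function Module CategoryTheory CategoryTheory.Limits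
open Literature.Topology.FourManifolds Literature.Geometry.Kaehler
  Literature.AlgebraicTopology.SingularHomology

namespace Literature.Geometry.Symplectic

namespace PlusOneSpherePair

variable {N : Type} [TopologicalSpace N] [ChartedSpace (EuclideanSpace ℝ (Fin 4)) N]
  {S : Type} [TopologicalSpace S] [CompactSpace S] [ChartedSpace (EuclideanSpace ℝ (Fin 2)) S]
  {b : S → N}

/-- **Step 1: `H₁(N ∖ b(S); ℤ) = 0 ⇒ H₁(N; ℤ) = 0`** for a smooth embedding `b` of a compact
surface into a (Hausdorff, second countable) `4`-manifold — the degree-`1`, codimension-`2` case of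
Kosinski 1993, X.1 Prop. (1.1) (`H₁(N ∖ S) → H₁(N)` is onto), for the tree's
`singularHomologyZ = H_•(·; ℤ)` of the fact. [cite: Kosinski1993, X.1 Prop. (1.1)] -/
theorem subsingleton_H1 [T2Space N] [SecondCountableTopology N]
    (hb : Manifold.IsSmoothEmbedding (𝓡 2) (𝓡 4) ∞ b)
    (h₁ : Subsingleton (singularHomologyZ (↥((range b)ᶜ)) 1)) :
    Subsingleton (singularHomologyZ N 1) :=
  haveI : Subsingleton (singularHomology ℤ ℤ (↥((range b)ᶜ)) 1) := h₁
  subsingleton_singularHomology_one_of_isSmoothEmbedding_two_four ℤ ℤ hb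

/-- Step 1 in `IsZero` form: `H₁(N; ℤ) = 0` in `ModuleCat ℤ`. [cite: Kosinski1993, X.1 Prop. (1.1)] -/
theorem isZero_H1 [T2Space N] [SecondCountableTopology N]
    (hb : Manifold.IsSmoothEmbedding (𝓡 2) (𝓡 4) ∞ b)
    (h₁ : Subsingleton (singularHomologyZ (↥((range b)ᶜ)) 1)) :
    IsZero (singularHomologyZ N 1) :=
  haveI := subsingleton_H1 hb h₁
  ModuleCat.isZero_of_subsingleton _

variable (s : MForm (𝓡 4) N ℝ 2)

/-- **Step 2: `H₂(N; ℤ) ≃ₗ[ℤ] ℤ`** under the hypotheses of the fact: `N` closed, `s` a smooth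
non-degenerate `2`-form (so `N` carries the symplectic `ℤ`-orientation `symplecticOrientation s`),
`b` a smooth embedding of a compact surface with `H₁(N ∖ b(S); ℤ) = 0` (so `H₁(N; ℤ) = 0`, step 1)
and `rank H₂(N; ℤ) = 1`: `H₂ ≅ H² = H²/T` is free of rank one (Kirby 1989, Ch. II §1 under
`H₁ = 0`; Poincaré duality, Hatcher Thm. 3.30). [cite: Kirby1989, Ch. II §1]
[cite: McDuff1990, Thm. 1.4 + Cor. 1.5 (i), p. 682] -/
theorem nonempty_H2_equiv_int [T2Space N] [SecondCountableTopology N] [CompactSpace N]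
    [IsManifold (𝓡 4) ∞ N] (hs : IsSmoothForm s)
    (hnd : ∀ x (v : TangentSpace (𝓡 4) x), v ≠ 0 → ∃ w : TangentSpace (𝓡 4) x, s x ![v, w] ≠ 0)
    (hb : Manifold.IsSmoothEmbedding (𝓡 2) (𝓡 4) ∞ b)
    (h₂ : Module.finrank ℤ (singularHomologyZ N 2) = 1)
    (h₁ : Subsingleton (singularHomologyZ (↥((range b)ᶜ)) 1)) :
    Nonempty (singularHomologyZ N 2 ≃ₗ[ℤ] ℤ) :=
  nonempty_singularHomology_two_equiv_int_of_finrank_eq_one (symplecticOrientation s hs hnd)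
    (isZero_H1 hb h₁) h₂

/-- Step 2, freeness: `H₂(N; ℤ)` is a free `ℤ`-module under the hypotheses of the fact (even
without the rank hypothesis). [cite: Kirby1989, Ch. II §1] -/
theorem free_H2 [T2Space N] [SecondCountableTopology N] [CompactSpace N] [IsManifold (𝓡 4) ∞ N]
    (hs : IsSmoothForm s)
    (hnd : ∀ x (v : TangentSpace (𝓡 4) x), v ≠ 0 → ∃ w : TangentSpace (𝓡 4) x, s x ![v, w] ≠ 0)
    (hb : Manifold.IsSmoothEmbedding (𝓡 2) (𝓡 4) ∞ b)
    (h₁ : Subsingleton (singularHomologyZ (↥((range b)ᶜ)) 1)) :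
    Module.Free ℤ (singularHomologyZ N 2) :=
  free_singularHomology_two_of_isZero_one (symplecticOrientation s hs hnd) (isZero_H1 hb h₁)

/-- Step 2, the second cohomology: `H²(N; ℤ)` is torsion-free and the Kronecker map
`H²(N; ℤ) → Hom(H₂(N; ℤ), ℤ)` is bijective under the hypotheses of the fact (universal
coefficients with `H₁ = 0`, Hatcher Thm. 3.2 / Cor. 3.3) — so that, with `H₂ ≅ ℤ`, also
`H²(N; ℤ) ≅ ℤ`, the lattice on which `[S]·[S]` is computed. [cite: HatcherAT2002, §3.1 Thm. 3.2 and Cor. 3.3] -/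
theorem kroneckerPairing_two_bijective [T2Space N] [SecondCountableTopology N]
    (hb : Manifold.IsSmoothEmbedding (𝓡 2) (𝓡 4) ∞ b)
    (h₁ : Subsingleton (singularHomologyZ (↥((range b)ᶜ)) 1)) :
    Function.Bijective (kroneckerPairing ℤ ℤ N 2) :=
  kroneckerPairing_two_bijective_of_isZero_one N (isZero_H1 hb h₁)


/-! ### Step 3: `a ↦ a·[S]` is onto `ℤ`, hence `[S]·[S] = ±1` -/

section Algebra

variable {R : Type*} [CommRing R] {V : Type*} [AddCommGroup V] [Module R V]

/-- In a free module of rank one with coordinate `e : V ≃ R` and generator `g = e⁻¹ 1`, every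
bilinear form satisfies `B c c' = (e c) (e c') · B g g`. [folklore] -/
theorem bilin_eq_mul_mul_of_equiv (e : V ≃ₗ[R] R) (B : V →ₗ[R] V →ₗ[R] R) (c c' : V) :
    B c c' = e c * e c' * B (e.symm 1) (e.symm 1) := by
  have hc : ∀ x : V, x = e x • e.symm 1 := fun x => by
    conv_lhs => rw [← e.symm_apply_apply x]
    rw [← e.symm.map_smul, smul_eq_mul, mul_one]
  conv_lhs => rw [hc c, hc c']
  rw [LinearMap.map_smul₂, LinearMap.map_smul, smul_eq_mul, smul_eq_mul]
  ring

end Algebra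

section AlgebraInt

variable {V : Type*} [AddCommGroup V] [Module ℤ V]

/-- In a free `ℤ`-module of rank one, if `B(·, σ)` is onto `ℤ` then `B σ σ = ±1` (`σ` and
`B g g` are then units). [folklore] -/
theorem bilin_self_eq_one_or_eq_neg_one_of_surjective (e : V ≃ₗ[ℤ] ℤ) (B : V →ₗ[ℤ] V →ₗ[ℤ] ℤ)
    (σ : V) (hσ : Function.Surjective (B.flip σ)) : B σ σ = 1 ∨ B σ σ = -1 := by
  obtain ⟨a, ha⟩ := hσ 1
  rw [LinearMap.flip_apply, bilin_eq_mul_mul_of_equiv e B] at ha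
  have hσ1 : e σ = 1 ∨ e σ = -1 :=
    Int.eq_one_or_neg_one_of_mul_eq_one (u := e σ) (v := e a * B (e.symm 1) (e.symm 1))
      (by linear_combination ha)
  have hg1 : B (e.symm 1) (e.symm 1) = 1 ∨ B (e.symm 1) (e.symm 1) = -1 :=
    Int.eq_one_or_neg_one_of_mul_eq_one (u := B (e.symm 1) (e.symm 1)) (v := e a * e σ)
      (by linear_combination ha)
  rw [bilin_eq_mul_mul_of_equiv e B σ σ]
  rcases hσ1 with h | h <;> rcases hg1 with h' | h' <;> simp [h, h']

/-- In a free `ℤ`-module of rank one, if `B(·, σ)` is onto `ℤ` then `B c c = (e c)² · B σ σ` for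
every `c`: all squares have the sign of `B σ σ`. [folklore] -/
theorem bilin_self_eq_sq_mul_of_surjective (e : V ≃ₗ[ℤ] ℤ) (B : V →ₗ[ℤ] V →ₗ[ℤ] ℤ)
    (σ : V) (hσ : Function.Surjective (B.flip σ)) (c : V) : B c c = e c ^ 2 * B σ σ := by
  obtain ⟨a, ha⟩ := hσ 1
  rw [LinearMap.flip_apply, bilin_eq_mul_mul_of_equiv e B] at ha
  have hσ1 : e σ = 1 ∨ e σ = -1 :=
    Int.eq_one_or_neg_one_of_mul_eq_one (u := e σ) (v := e a * B (e.symm 1) (e.symm 1))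
      (by linear_combination ha)
  have hsq : e σ * e σ = 1 := by rcases hσ1 with h | h <;> simp [h]
  rw [bilin_eq_mul_mul_of_equiv e B c c, bilin_eq_mul_mul_of_equiv e B σ σ]
  linear_combination (-(e c ^ 2 * B (e.symm 1) (e.symm 1))) * hsq

end AlgebraInt

section SelfIntersection

variable [T2Space N] [CompactSpace N]

omit [CompactSpace S] in
/-- The Poincaré dual `σ ∈ H²(N; ℤ)` of the class `b_*[S] ∈ H₂(N; ℤ)` of the oriented surface
(`σ ⌢ [N] = b_*[S]`) exists and is unique, Poincaré duality being bijective (the tree's theorem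
`poincare_duality`, Hatcher Thm. 3.30). [cite: HatcherAT2002, §3.3 Thm. 3.30] -/
theorem existsUnique_poincareDual (μ : HomologicalOrientation ℤ N 4)
    (μS : HomologicalOrientation ℤ S 2) (hb : Manifold.IsSmoothEmbedding (𝓡 2) (𝓡 4) ∞ b) :
    ∃! σ : singularCohomology ℤ ℤ N 2, poincareDualityMap μ two_add_two_eq_four σ =
      singularHomology.map ℤ ℤ ⟨b, hb.isEmbedding.continuous⟩ 2 μS.fundamentalClass :=
  (show Function.Bijective (poincareDualityMap μ two_add_two_eq_four) from
    poincare_duality μ two_add_two_eq_four).existsUnique _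

/-- **`H²(N; ℤ) ≃ₗ[ℤ] ℤ`** under the hypotheses of the fact (for any `ℤ`-orientation `μ`):
Poincaré duality `H² ≅ H₂` composed with `H₂(N; ℤ) ≅ ℤ` (steps 1–2).
[cite: Kirby1989, Ch. II §1] [cite: HatcherAT2002, §3.3 Thm. 3.30] -/
theorem nonempty_cohomologyTwo_equiv_int [SecondCountableTopology N]
    (μ : HomologicalOrientation ℤ N 4) (hb : Manifold.IsSmoothEmbedding (𝓡 2) (𝓡 4) ∞ b)
    (h₂ : Module.finrank ℤ (singularHomologyZ N 2) = 1)
    (h₁ : Subsingleton (singularHomologyZ (↥((range b)ᶜ)) 1)) :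
    Nonempty (singularCohomology ℤ ℤ N 2 ≃ₗ[ℤ] ℤ) := by
  obtain ⟨E⟩ := nonempty_singularHomology_two_equiv_int_of_finrank_eq_one μ (isZero_H1 hb h₁) h₂
  exact ⟨(poincareDualityEquiv μ two_add_two (poincare_duality μ _)).trans E⟩

/-- **Step 3a: `a ↦ a·[S] = ⟨a ∪ σ, [N]⟩` maps `H²(N; ℤ)` ONTO `ℤ`** when `H₁(N ∖ b(S); ℤ) = 0`:
in the Thom–Gysin sequence `H²(N) —(·[S])→ ℤ —δ→ H₁(N ∖ S) → H₁(N) → 0` of the complement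
(Bredon 1993, VI.11; the tree's theorem `thomGysin_complement_surface_four_holds`) the connecting
map `δ` lands in `0`, so `ker δ = ℤ` is the image of `·[S]`. Any orientations `μ`, `μS`; `σ` the
Poincaré dual of `b_*[S]`. [cite: Bredon1993, Ch. VI Def. 11.8, Thm. 11.3]
[cite: HatcherAT2002, §2.1 Thm. 2.16] -/
theorem cupPairing_flip_surjective [SecondCountableTopology N] [IsManifold (𝓡 4) ∞ N]
    [ConnectedSpace S] [IsManifold (𝓡 2) ∞ S] (μ : HomologicalOrientation ℤ N 4)
    (μS : HomologicalOrientation ℤ S 2) (hb : Manifold.IsSmoothEmbedding (𝓡 2) (𝓡 4) ∞ b)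
    (h₁ : Subsingleton (singularHomologyZ (↥((range b)ᶜ)) 1)) (σ : singularCohomology ℤ ℤ N 2)
    (hσ : poincareDualityMap μ two_add_two_eq_four σ =
      singularHomology.map ℤ ℤ ⟨b, hb.isEmbedding.continuous⟩ 2 μS.fundamentalClass) :
    Function.Surjective ((cupPairing μ two_add_two_eq_four).flip σ) := by
  obtain ⟨-, δ, -, hker⟩ := thomGysin_complement_surface_four_holds N μ S μS b hb σ hσ
  haveI : Subsingleton (singularHomology ℤ ℤ (↥((range b)ᶜ)) 1) := h₁
  have hδ : δ = 0 := LinearMap.ext fun x => Subsingleton.elim _ _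
  rw [hδ, LinearMap.ker_zero] at hker
  exact LinearMap.range_eq_top.1 hker.symm

/-- **Step 3b: `[S]·[S] = ⟨σ ∪ σ, [N]⟩ = ±1`** under the hypotheses of the fact (`N` closed with a
`ℤ`-orientation `μ`, `S` compact connected with an orientation `μS`, `b` a smooth embedding,
`rank H₂(N; ℤ) = 1`, `H₁(N ∖ b(S); ℤ) = 0`; `σ` the Poincaré dual of `b_*[S]`): `H²(N; ℤ) = ℤg`
and `·[S]` is onto, so `σ = ±g` and `g·g = ±1`. (The SIGN `+1` is the symplectic input
`[s]² > 0`, not proved here.) [cite: McDuff1990, Thm. 1.4 + Cor. 1.5 (i), p. 682]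
[cite: Bredon1993, Ch. VI §9.4 and §11] -/
theorem selfIntersection_eq_one_or_eq_neg_one [SecondCountableTopology N] [IsManifold (𝓡 4) ∞ N]
    [ConnectedSpace S] [IsManifold (𝓡 2) ∞ S] (μ : HomologicalOrientation ℤ N 4)
    (μS : HomologicalOrientation ℤ S 2) (hb : Manifold.IsSmoothEmbedding (𝓡 2) (𝓡 4) ∞ b)
    (h₂ : Module.finrank ℤ (singularHomologyZ N 2) = 1)
    (h₁ : Subsingleton (singularHomologyZ (↥((range b)ᶜ)) 1)) (σ : singularCohomology ℤ ℤ N 2)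
    (hσ : poincareDualityMap μ two_add_two_eq_four σ =
      singularHomology.map ℤ ℤ ⟨b, hb.isEmbedding.continuous⟩ 2 μS.fundamentalClass) :
    cupPairing μ two_add_two_eq_four σ σ = 1 ∨ cupPairing μ two_add_two_eq_four σ σ = -1 := by
  obtain ⟨e⟩ := nonempty_cohomologyTwo_equiv_int μ hb h₂ h₁
  exact bilin_self_eq_one_or_eq_neg_one_of_surjective e _ σ
    (cupPairing_flip_surjective μ μS hb h₁ σ hσ)

/-- **Step 3c: every class has square `c·c = k² · [S]·[S]`** (`k` the coordinate of `c` in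
`H²(N; ℤ) = ℤg`), under the hypotheses of the fact. [cite: Bredon1993, Ch. VI §9.4 and §11] -/
theorem cupPairing_self_eq_sq_mul_selfIntersection [SecondCountableTopology N]
    [IsManifold (𝓡 4) ∞ N] [ConnectedSpace S] [IsManifold (𝓡 2) ∞ S]
    (μ : HomologicalOrientation ℤ N 4) (μS : HomologicalOrientation ℤ S 2)
    (hb : Manifold.IsSmoothEmbedding (𝓡 2) (𝓡 4) ∞ b)
    (h₂ : Module.finrank ℤ (singularHomologyZ N 2) = 1)
    (h₁ : Subsingleton (singularHomologyZ (↥((range b)ᶜ)) 1)) (σ : singularCohomology ℤ ℤ N 2)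
    (hσ : poincareDualityMap μ two_add_two_eq_four σ =
      singularHomology.map ℤ ℤ ⟨b, hb.isEmbedding.continuous⟩ 2 μS.fundamentalClass)
    (c : singularCohomology ℤ ℤ N 2) :
    ∃ k : ℤ, cupPairing μ two_add_two_eq_four c c = k ^ 2 * cupPairing μ two_add_two_eq_four σ σ := by
  obtain ⟨e⟩ := nonempty_cohomologyTwo_equiv_int μ hb h₂ h₁
  exact ⟨e c, bilin_self_eq_sq_mul_of_surjective e _ σ
    (cupPairing_flip_surjective μ μS hb h₁ σ hσ) c⟩

/-- **Homological minimality ⟺ `[S]·[S] = +1`**: under the hypotheses of the fact, no class of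
`H²(N; ℤ)` has square `−1` if and only if `[S]·[S] = 1` (the two possible lattices being `⟨+1⟩`
and `⟨−1⟩`). With the symplectic sign `[S]·[S] = +1` (step 4, `[s]² > 0`) this is the printed
hypothesis "`N` minimal" (no sphere — indeed no class — of self-intersection `−1`).
[cite: McDuff1990, pp. 679–680 (minimal pairs)] [cite: Wendl2018, Def. 1.9] -/
theorem forall_cupPairing_self_ne_neg_one_iff [SecondCountableTopology N] [IsManifold (𝓡 4) ∞ N]
    [ConnectedSpace S] [IsManifold (𝓡 2) ∞ S] (μ : HomologicalOrientation ℤ N 4)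
    (μS : HomologicalOrientation ℤ S 2) (hb : Manifold.IsSmoothEmbedding (𝓡 2) (𝓡 4) ∞ b)
    (h₂ : Module.finrank ℤ (singularHomologyZ N 2) = 1)
    (h₁ : Subsingleton (singularHomologyZ (↥((range b)ᶜ)) 1)) (σ : singularCohomology ℤ ℤ N 2)
    (hσ : poincareDualityMap μ two_add_two_eq_four σ =
      singularHomology.map ℤ ℤ ⟨b, hb.isEmbedding.continuous⟩ 2 μS.fundamentalClass) :
    (∀ c : singularCohomology ℤ ℤ N 2, cupPairing μ two_add_two_eq_four c c ≠ -1) ↔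
      cupPairing μ two_add_two_eq_four σ σ = 1 := by
  constructor
  · intro h
    exact (selfIntersection_eq_one_or_eq_neg_one μ μS hb h₂ h₁ σ hσ).resolve_right (h σ)
  · intro h c hc
    obtain ⟨k, hk⟩ := cupPairing_self_eq_sq_mul_selfIntersection μ μS hb h₂ h₁ σ hσ c
    rw [h, mul_one] at hk
    rw [hk] at hc
    nlinarith [sq_nonneg k]

end SelfIntersection

end PlusOneSpherePair

end Literature.Geometry.Symplectic
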